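import Summits.Ventures.PercRepro0.ZhangArms

/-!
# P1 · HARRIS (Zhang's argument), part B: arms decrease in `M`, the union lemmas, Lemma 1.4

Cell pub-perc-repro0, seat p2.  On the objects of `ZhangArms.lean`:

* Lemma 1.3(c): `armP S n M` and `darm S n M` decrease in `M ≥ n+2` when `S` is a side of the ring
  (`armP_subset_of_le`, `darm_subset_of_le`; first-exit along `nrm` / `dn`);
* the sides: `nrm = n+1` on the four primal sides, `dn = n` on the four dual sides; `{dn = n}` is the
  union of the four dual sides; a vertex outside `Λ_n` adjacent to `Λ_n` lies on a corner-free side;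
* Lemma 2.1: `boxInf n ⊆ armPInf L ∪ armPInf R ∪ armPInf T ∪ armPInf Bo` (`boxInf_subset_arms`) and
  `dualBoxInf n ⊆ armDInf T* ∪ armDInf B* ∪ armDInf L* ∪ armDInf R*` (`dualBoxInf_subset_darms`);
* the events `boxInf n` (= `E_n`), `dboxInf n`, `dualBoxInf n` (= `E*_n`).
(Lemma 1.4 and the limits `P_p(E_n) → P_p(∃ infinite cluster)` are in `ZhangLimits.lean`.)
-/

open MeasureTheory ProbabilityTheory unitInterval
open scoped ENNReal Topology

namespace Summit.Ventures.PercRepro0.Zhang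

open Summit.Ventures.PercRepro0.Defs Summit.Ventures.PercRepro0.L2 Summit.Ventures.PercRepro0.DualMap
  Summit.Ventures.PercRepro0.Crossing

-- BEGIN BODY

open Summit.Ventures.PercRepro0.L2 Summit.Ventures.PercRepro0.DualMap Summit.Ventures.PercRepro0.Crossing

/-! ### Lemma 1.3(c): the arm events decrease in `M` -/

/-- Along a lattice bond each coordinate moves by at most one. -/
lemma coord_le_of_adj {x y : Vertex 2} (h : (lattice 2).Adj x y) :
    |x 0 - y 0| ≤ 1 ∧ |x 1 - y 1| ≤ 1 := by
  rw [lattice_adj_iff] at h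
  have h0 := abs_nonneg (x 0 - y 0)
  have h1 := abs_nonneg (x 1 - y 1)
  constructor <;> linarith

/-- Along a lattice bond `dn` grows by at most one. -/
lemma dn_le_of_adj {x y : Vertex 2} (h : (lattice 2).Adj x y) : dn y ≤ dn x + 1 := by
  obtain ⟨h0, h1⟩ := coord_le_of_adj h
  rw [abs_le] at h0 h1
  simp only [dn]
  omega

/-- Along a lattice bond the sup-norm grows by at most one (integer form). -/
lemma nrm_int_le_of_adj {x y : Vertex 2} (h : (lattice 2).Adj x y) :
    ((nrm y : ℕ) : ℤ) ≤ (nrm x : ℕ) + 1 := by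
  have := nrm_le_of_adj h
  omega

/-- `nrm` in coordinates (`d = 2`): `nrm x ≤ m ↔ |x 0| ≤ m ∧ |x 1| ≤ m`. -/
lemma nrm_le_iff_two {x : Vertex 2} {m : ℕ} : nrm x ≤ m ↔ |x 0| ≤ m ∧ |x 1| ≤ m := by
  rw [nrm_le_iff, Fin.forall_fin_two, Int.abs_eq_natAbs, Int.abs_eq_natAbs]
  omega

/-- `x ∈ ∂Λ_M` (`M ≥ 1`) iff `nrm x = M`. -/
lemma mem_boundary_iff_nrm {M : ℕ} (hM : 1 ≤ M) {x : Vertex 2} :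
    x ∈ boundary 2 M ↔ nrm x = M := mem_boundary_iff hM

/-- The primal arm events decrease in `M` (for sides of the ring `Λ_{n+1} ∖ Λ_n`). -/
lemma armP_succ_subset {n : ℕ} {S : Set (Vertex 2)} (hS : ∀ u ∈ S, nrm u = n + 1) {M : ℕ}
    (hM : n + 2 ≤ M) : armP S n (M + 1) ⊆ armP S n M := by
  rintro ω ⟨u, hu, y, hy, hpath⟩
  have hyM : nrm y = M + 1 := (mem_boundary_iff_nrm (by omega)).1 hy
  obtain ⟨z, hz, hzpath⟩ := exists_level (f := fun v => ((nrm v : ℕ) : ℤ))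
    (fun a b hab => nrm_int_le_of_adj hab.1) hpath (m := M)
    (by rw [hS u hu]; omega) (by rw [hyM]; omega)
  exact ⟨u, hu, z, (mem_boundary_iff_nrm (by omega)).2 (by exact_mod_cast hz), hzpath⟩

/-- `armP S n` is antitone on `[n+2, ∞)`. -/
lemma armP_subset_of_le {n : ℕ} {S : Set (Vertex 2)} (hS : ∀ u ∈ S, nrm u = n + 1) {M M' : ℕ}
    (hM' : n + 2 ≤ M') (hle : M' ≤ M) : armP S n M ⊆ armP S n M' := by
  induction M, hle using Nat.le_induction with
  | base => exact le_rfl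
  | succ M'' hM'' ih => exact (armP_succ_subset hS (by omega)).trans ih

/-- The dual arm events decrease in `M` (for the dual sides, `dn = n`). -/
lemma darm_succ_subset {n : ℕ} {S : Set (Vertex 2)} (hS : ∀ t ∈ S, dn t = n) {M : ℕ}
    (hM : n + 2 ≤ M) : darm S n (M + 1) ⊆ darm S n M := by
  rintro ω' ⟨t, ht, y, hy, hpath⟩
  have hyM : dn y = M + 1 := hy
  obtain ⟨z, hz, hzpath⟩ := exists_level (f := dn) (fun a b hab => dn_le_of_adj hab.1) hpath
    (m := M) (by rw [hS t ht]; omega) (by rw [hyM]; omega)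
  exact ⟨t, ht, z, hz, hzpath⟩

/-- `darm S n` is antitone on `[n+2, ∞)`. -/
lemma darm_subset_of_le {n : ℕ} {S : Set (Vertex 2)} (hS : ∀ t ∈ S, dn t = n) {M M' : ℕ}
    (hM' : n + 2 ≤ M') (hle : M' ≤ M) : darm S n M ⊆ darm S n M' := by
  induction M, hle using Nat.le_induction with
  | base => exact le_rfl
  | succ M'' hM'' ih => exact (darm_succ_subset hS (by omega)).trans ih

/-- The four primal sides have sup-norm `n+1`. -/
lemma nrm_eq_of_mem_leftSide {n : ℕ} {u : Vertex 2} (h : u ∈ leftSide n) : nrm u = n + 1 := by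
  obtain ⟨h0, h1⟩ := h
  have h1' := abs_le.1 h1
  apply le_antisymm
  · rw [nrm_le_iff_two]; exact ⟨abs_le.2 ⟨by omega, by omega⟩, abs_le.2 ⟨by omega, by omega⟩⟩
  · have := natAbs_le_nrm u 0
    rw [h0] at this
    omega

/-- `R_n` has sup-norm `n+1`. -/
lemma nrm_eq_of_mem_rightSide {n : ℕ} {u : Vertex 2} (h : u ∈ rightSide n) : nrm u = n + 1 := by
  obtain ⟨h0, h1⟩ := h
  have h1' := abs_le.1 h1
  apply le_antisymm
  · rw [nrm_le_iff_two]; exact ⟨abs_le.2 ⟨by omega, by omega⟩, abs_le.2 ⟨by omega, by omega⟩⟩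
  · have := natAbs_le_nrm u 0
    rw [h0] at this
    omega

/-- `T_n` has sup-norm `n+1`. -/
lemma nrm_eq_of_mem_topSide {n : ℕ} {u : Vertex 2} (h : u ∈ topSide n) : nrm u = n + 1 := by
  obtain ⟨h1, h0⟩ := h
  have h0' := abs_le.1 h0
  apply le_antisymm
  · rw [nrm_le_iff_two]; exact ⟨abs_le.2 ⟨by omega, by omega⟩, abs_le.2 ⟨by omega, by omega⟩⟩
  · have := natAbs_le_nrm u 1
    rw [h1] at this
    omega

/-- `Bo_n` has sup-norm `n+1`. -/
lemma nrm_eq_of_mem_botSide {n : ℕ} {u : Vertex 2} (h : u ∈ botSide n) : nrm u = n + 1 := by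
  obtain ⟨h1, h0⟩ := h
  have h0' := abs_le.1 h0
  apply le_antisymm
  · rw [nrm_le_iff_two]; exact ⟨abs_le.2 ⟨by omega, by omega⟩, abs_le.2 ⟨by omega, by omega⟩⟩
  · have := natAbs_le_nrm u 1
    rw [h1] at this
    omega

/-- The four dual sides have `dn = n`. -/
lemma dn_eq_of_mem_topDual {n : ℕ} {t : Vertex 2} (h : t ∈ topDual n) : dn t = n := by
  obtain ⟨h0, h1, h2⟩ := h; simp only [dn]; omega
/-- `dn = n` on `ψ(B*_n)`. -/
lemma dn_eq_of_mem_botDual {n : ℕ} {t : Vertex 2} (h : t ∈ botDual n) : dn t = n := by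
  obtain ⟨h0, h1, h2⟩ := h; simp only [dn]; omega
/-- `dn = n` on `ψ(L*_n)`. -/
lemma dn_eq_of_mem_leftDual {n : ℕ} {t : Vertex 2} (h : t ∈ leftDual n) : dn t = n := by
  obtain ⟨h0, h1, h2⟩ := h; simp only [dn]; omega
/-- `dn = n` on `ψ(R*_n)`. -/
lemma dn_eq_of_mem_rightDual {n : ℕ} {t : Vertex 2} (h : t ∈ rightDual n) : dn t = n := by
  obtain ⟨h0, h1, h2⟩ := h; simp only [dn]; omega

/-- `{dn = n}` is the union of the four dual sides. -/
lemma mem_dualSides_of_dn {n : ℕ} {t : Vertex 2} (h : dn t = n) :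
    t ∈ topDual n ∨ t ∈ botDual n ∨ t ∈ leftDual n ∨ t ∈ rightDual n := by
  simp only [dn] at h
  simp only [topDual, botDual, leftDual, rightDual, Set.mem_setOf_eq]
  omega

/-- A vertex outside `Λ_n` adjacent to a vertex of `Λ_n` lies on one of the four corner-free sides. -/
lemma mem_sides_of_exit {n : ℕ} {t u : Vertex 2} (ht : t ∈ box 2 n) (hu : u ∉ box 2 n)
    (hadj : (lattice 2).Adj t u) :
    u ∈ leftSide n ∨ u ∈ rightSide n ∨ u ∈ topSide n ∨ u ∈ botSide n := by
  rw [mem_box_two] at ht hu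
  obtain ⟨h0, h1⟩ := coord_le_of_adj hadj
  rw [lattice_adj_iff] at hadj
  rw [abs_le] at h0 h1
  obtain ⟨ht0, ht1⟩ := ht
  rw [abs_le] at ht0 ht1
  simp only [leftSide, rightSide, topSide, botSide, Set.mem_setOf_eq, abs_le]
  rcases abs_cases (t 0 - u 0) with ⟨e0, _⟩ | ⟨e0, _⟩ <;>
  rcases abs_cases (t 1 - u 1) with ⟨e1, _⟩ | ⟨e1, _⟩ <;>
  · rw [e0, e1] at hadj
    simp only [abs_le, not_and_or, not_le] at hu
    omega

/-! ### Lemma 2.1: an infinite cluster meeting the box gives an arm -/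

/-- Pigeonhole over a finite family of antitone events: if for every `M ≥ m` some member contains
`ω`, then one member contains `ω` for every `M ≥ m`. -/
lemma exists_forall_of_forall_exists {ι : Type*} [Fintype ι] {A : ι → ℕ → Set (Config 2)} {m : ℕ}
    (hanti : ∀ i M M', m ≤ M' → M' ≤ M → A i M ⊆ A i M') {ω : Config 2}
    (h : ∀ M, m ≤ M → ∃ i, ω ∈ A i M) : ∃ i, ∀ M, m ≤ M → ω ∈ A i M := by
  by_contra hcon
  push Not at hcon
  choose f hf using hcon
  obtain ⟨i, hi⟩ := h (Finset.univ.sup f ⊔ m) le_sup_right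
  have hfi : f i ≤ Finset.univ.sup f ⊔ m := le_sup_of_le_left (Finset.le_sup (Finset.mem_univ i))
  exact (hf i).2 (hanti i _ _ (hf i).1 hfi hi)

/-- The event `E_n`: some vertex of `Λ_n` lies in an infinite cluster. -/
def boxInf (n : ℕ) : Set (Config 2) := {ω | ∃ v ∈ box 2 n, ConnInf 2 ω v}

/-- The event `E*_n` in ψ-coordinates, for a configuration playing the dual: some vertex of
`ψ(Λ*_n)` lies in an infinite cluster. -/
def dboxInf (n : ℕ) : Set (Config 2) := {ω' | ∃ f ∈ dualBox n, ConnInf 2 ω' f}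

/-- The event `E*_n`: some dual vertex of `Λ*_n` lies in an infinite dual cluster. -/
def dualBoxInf (n : ℕ) : Set (Config 2) := dualConfig ⁻¹' dboxInf n

/-- An infinite set of vertices is unbounded in sup-norm. -/
lemma exists_nrm_ge_of_infinite {C : Set (Vertex 2)} (hC : C.Infinite) (M : ℕ) :
    ∃ y ∈ C, M ≤ nrm y := by
  by_contra h
  push Not at h
  exact hC ((finite_box M).subset fun y hy => (h y hy).le)

/-- `dualBox M` is finite. -/
lemma finite_dualBox (M : ℕ) : (dualBox M).Finite :=
  (finite_box (M + 1)).subset fun x hx => by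
    rw [mem_dualBox] at hx
    rw [Set.mem_setOf_eq, nrm_le_iff_two]
    exact ⟨abs_le.2 ⟨by omega, by omega⟩, abs_le.2 ⟨by omega, by omega⟩⟩

/-- An infinite set of vertices is unbounded in `dn`. -/
lemma exists_dn_ge_of_infinite {C : Set (Vertex 2)} (hC : C.Infinite) (M : ℕ) :
    ∃ y ∈ C, (M : ℤ) ≤ dn y := by
  by_contra h
  push Not at h
  exact hC ((finite_dualBox M).subset fun y hy => (h y hy).le)

/-- Lemma 2.1(a), one scale: if a vertex of `Λ_n` has an infinite cluster, some corner-free side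
carries an arm to `∂Λ_M`. -/
lemma mem_armP_of_boxInf {n M : ℕ} (hM : n + 2 ≤ M) {ω : Config 2} (hω : ω ∈ boxInf n) :
    ω ∈ armP (leftSide n) n M ∨ ω ∈ armP (rightSide n) n M ∨ ω ∈ armP (topSide n) n M ∨
      ω ∈ armP (botSide n) n M := by
  obtain ⟨v, hv, hinf⟩ := hω
  obtain ⟨y, hy, hyM⟩ := exists_nrm_ge_of_infinite hinf M
  have hpath : Relation.ReflTransGen (OAdj ω) v y := (conn_iff_reflTransGen ω v y).1 hy
  have hyn : y ∉ box 2 n := by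
    intro hyb
    have : nrm y ≤ n := nrm_le_iff.2 fun i => by
      have := hyb i
      rw [Int.abs_eq_natAbs] at this
      omega
    omega
  obtain ⟨t, ht, u, hu, htu, hrest⟩ := exists_exit' hpath hv hyn
  -- the suffix avoids `E_n^+`
  have hoff : Relation.ReflTransGen (OffAdj n ω) u y :=
    reflTransGen_mono (fun a b hab => ⟨hab.1.1, hab.1.2, fun hmem =>
      by
        rcases (pair_mem_boxPlusBonds ((SimpleGraph.mem_edgeSet (lattice 2)).2 hab.1.1)).1 hmem with
          h | h
        · exact hab.2.1 h
        · exact hab.2.2 h⟩) hrest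
  have hnu : nrm u = n + 1 := by
    have h1 := nrm_le_of_adj htu.1
    have h2 : nrm t ≤ n := nrm_le_iff.2 fun i => by
      have := ht i
      rw [Int.abs_eq_natAbs] at this
      omega
    have h3 : ¬ nrm u ≤ n := fun hle => hu fun i => by
      have := natAbs_le_nrm u i
      rw [Int.abs_eq_natAbs]
      omega
    omega
  obtain ⟨z, hz, hzpath⟩ := exists_level (f := fun v => ((nrm v : ℕ) : ℤ))
    (fun a b hab => nrm_int_le_of_adj hab.1) hoff (m := M) (by rw [hnu]; omega) (by omega)
  have hzB : z ∈ boundary 2 M := (mem_boundary_iff_nrm (by omega)).2 (by exact_mod_cast hz)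
  rcases mem_sides_of_exit ht hu htu.1 with hs | hs | hs | hs
  · exact Or.inl ⟨u, hs, z, hzB, hzpath⟩
  · exact Or.inr (Or.inl ⟨u, hs, z, hzB, hzpath⟩)
  · exact Or.inr (Or.inr (Or.inl ⟨u, hs, z, hzB, hzpath⟩))
  · exact Or.inr (Or.inr (Or.inr ⟨u, hs, z, hzB, hzpath⟩))

/-- The four primal sides, indexed by `Fin 4`. -/
def pside (n : ℕ) : Fin 4 → Set (Vertex 2) := ![leftSide n, rightSide n, topSide n, botSide n]

/-- `nrm = n+1` on every primal side. -/
lemma nrm_eq_of_mem_pside {n : ℕ} (i : Fin 4) {u : Vertex 2} (h : u ∈ pside n i) : nrm u = n + 1 := by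
  fin_cases i
  · exact nrm_eq_of_mem_leftSide h
  · exact nrm_eq_of_mem_rightSide h
  · exact nrm_eq_of_mem_topSide h
  · exact nrm_eq_of_mem_botSide h

/-- Lemma 2.1(a): `E_n ⊆ A^L_n ∪ A^R_n ∪ A^T_n ∪ A^{Bo}_n`. -/
lemma boxInf_subset_arms (n : ℕ) :
    boxInf n ⊆ armPInf (leftSide n) n ∪ armPInf (rightSide n) n ∪ armPInf (topSide n) n ∪
      armPInf (botSide n) n := by
  intro ω hω
  have h : ∀ M, n + 2 ≤ M → ∃ i : Fin 4, ω ∈ armP (pside n i) n M := fun M hM => by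
    rcases mem_armP_of_boxInf hM hω with h | h | h | h
    · exact ⟨0, h⟩
    · exact ⟨1, h⟩
    · exact ⟨2, h⟩
    · exact ⟨3, h⟩
  obtain ⟨i, hi⟩ := exists_forall_of_forall_exists (A := fun i M => armP (pside n i) n M)
    (fun i M M' hM' hle => armP_subset_of_le (fun u hu => nrm_eq_of_mem_pside i hu) hM' hle) h
  have hmem : ω ∈ armPInf (pside n i) n := Set.mem_iInter₂.2 hi
  fin_cases i
  · exact Or.inl (Or.inl (Or.inl hmem))
  · exact Or.inl (Or.inl (Or.inr hmem))
  · exact Or.inl (Or.inr hmem)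
  · exact Or.inr hmem

/-- Lemma 2.1(b), one scale, in ψ-coordinates. -/
lemma mem_darm_of_dboxInf {n M : ℕ} (hM : n + 2 ≤ M) {ω' : Config 2} (hω : ω' ∈ dboxInf n) :
    ω' ∈ darm (topDual n) n M ∨ ω' ∈ darm (botDual n) n M ∨ ω' ∈ darm (leftDual n) n M ∨
      ω' ∈ darm (rightDual n) n M := by
  obtain ⟨f, hf, hinf⟩ := hω
  obtain ⟨y, hy, hyM⟩ := exists_dn_ge_of_infinite hinf M
  have hpath : Relation.ReflTransGen (OAdj ω') f y := (conn_iff_reflTransGen ω' f y).1 hy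
  have hyn : y ∉ dualBox n := fun hyb => by
    have : dn y ≤ n := hyb
    omega
  obtain ⟨t, ht, hrest⟩ := exists_exit hpath hf hyn
  -- the suffix uses no bond of `dualBoxBonds n`
  have hD : Relation.ReflTransGen (DAdj n ω') t y :=
    reflTransGen_mono (fun a b hab => ⟨hab.1.1, hab.1.2, fun hmem => hab.2 (pair_mem_dualBoxBonds.1 hmem).2⟩)
      hrest
  have hdt : dn t = n := by
    have htn : dn t ≤ n := ht
    rcases hrest.cases_head with rfl | ⟨u, hu, _⟩
    · exact absurd ht hyn
    · have h1 := dn_le_of_adj hu.1.1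
      have h2 : ¬ dn u ≤ n := hu.2
      omega
  obtain ⟨z, hz, hzpath⟩ := exists_level (f := dn) (fun a b hab => dn_le_of_adj hab.1) hD
    (m := M) (by rw [hdt]; omega) hyM
  have hzB : z ∈ dualBoundary M := hz
  rcases mem_dualSides_of_dn hdt with hs | hs | hs | hs
  · exact Or.inl ⟨t, hs, z, hzB, hzpath⟩
  · exact Or.inr (Or.inl ⟨t, hs, z, hzB, hzpath⟩)
  · exact Or.inr (Or.inr (Or.inl ⟨t, hs, z, hzB, hzpath⟩))
  · exact Or.inr (Or.inr (Or.inr ⟨t, hs, z, hzB, hzpath⟩))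

/-- The four dual sides, indexed by `Fin 4`. -/
def dside (n : ℕ) : Fin 4 → Set (Vertex 2) := ![topDual n, botDual n, leftDual n, rightDual n]

/-- `dn = n` on every dual side. -/
lemma dn_eq_of_mem_dside {n : ℕ} (i : Fin 4) {t : Vertex 2} (h : t ∈ dside n i) : dn t = n := by
  fin_cases i
  · exact dn_eq_of_mem_topDual h
  · exact dn_eq_of_mem_botDual h
  · exact dn_eq_of_mem_leftDual h
  · exact dn_eq_of_mem_rightDual h

/-- Lemma 2.1(b): `E*_n ⊆ A*^{T*}_n ∪ A*^{B*}_n ∪ A*^{L*}_n ∪ A*^{R*}_n`. -/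
lemma dualBoxInf_subset_darms (n : ℕ) :
    dualBoxInf n ⊆ armDInf (topDual n) n ∪ armDInf (botDual n) n ∪ armDInf (leftDual n) n ∪
      armDInf (rightDual n) n := by
  intro ω hω
  have h : ∀ M, n + 2 ≤ M → ∃ i : Fin 4, ω ∈ armD (dside n i) n M := fun M hM => by
    rcases mem_darm_of_dboxInf hM hω with h | h | h | h
    · exact ⟨0, h⟩
    · exact ⟨1, h⟩
    · exact ⟨2, h⟩
    · exact ⟨3, h⟩
  obtain ⟨i, hi⟩ := exists_forall_of_forall_exists (A := fun i M => armD (dside n i) n M)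
    (fun i M M' hM' hle => Set.preimage_mono
      (darm_subset_of_le (fun t ht => dn_eq_of_mem_dside i ht) hM' hle)) h
  have hmem : ω ∈ armDInf (dside n i) n := Set.mem_iInter₂.2 hi
  fin_cases i
  · exact Or.inl (Or.inl (Or.inl hmem))
  · exact Or.inl (Or.inl (Or.inr hmem))
  · exact Or.inl (Or.inr hmem)
  · exact Or.inr hmem

-- END BODY

end Summit.Ventures.PercRepro0.Zhang
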